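import Literature.Analysis.SegalBargmann.HermiteSchwartz
import Mathlib.Analysis.Distribution.SchwartzSpace.Deriv
import HarnessLib

/-!
# The Hermite operators `2π(D_j² + X_j²)` on Schwartz space and their eigenfunctions (Folland 1989, §1.7)

Topic `Analysis/SegalBargmann`; namespace `Literature.Analysis.SegalBargmann`.  Continuation of
`Literature.Analysis.SegalBargmann.HermiteSchwartz`: there the Hermite span `hermiteSchwartz p ∈ 𝓢(ℝ^σ, ℂ)`
(`p ∈ ℂ[x_σ]` the polynomial SYMBOL, `hermiteSchwartz p (x) = p(x) e^{−π|x|²}`) was shown stable under LINEAR VECTOR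
FIELDS (first-order operators).  This file adds the SECOND-ORDER operators of the harmonic oscillator, as honest
continuous linear operators on Schwartz space (Mathlib's `LineDeriv` calculus on `𝓢`, `SchwartzMap.smulLeftCLM`), and
identifies their action on the Hermite span with Folland's symbol calculus of `Literature.Analysis.SegalBargmann.FockHermite`:

* §1 `fderiv_hermiteSchwartz_apply`, `lineDerivOp_hermiteSchwartz`, `lineDerivOp_single_hermiteSchwartz` — the directional
  derivative `∂_{v}` of `𝓢(ℝ^σ, ℂ)` acts on the Hermite span by the symbol `dirSymb v` (`= opDel j = ∂_j − 2πx_j` for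
  `v = e_j`).
* §2 `coordMulCLM j` — multiplication by the coordinate `x_j` as an operator on `𝓢(ℝ^σ, ℂ)` (symbol `opX j`).
* §3 `opDCLM j = (2πi)⁻¹ ∂_j` (Folland's `D_j`, symbol `opD j`) and the **Hermite operator**
  `hermiteOpCLM j = 2π(D_j² + X_j²) = −(2π)⁻¹∂_j² + 2π x_j²` on `𝓢(ℝ^σ, ℂ)`, with
  `hermiteOpCLM_hermiteSchwartz : hermiteOpCLM j (hermiteSchwartz p) = hermiteSchwartz (hermiteOp j p)` and the
  EIGENVALUE EQUATION `hermiteOpCLM_herm : hermiteOpCLM j h_α = (2α_j + 1) h_α` for the Hermite functions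
  `h_α = hermiteSchwartz (herm α)` — Folland 1989 §1.7 (vi) / Theorem (1.83)(a): "the `h_α` are eigenfunctions of
  `2π(D_j² + X_j²)` with eigenvalue `2α_j + 1`".
* §4 the **number operator** `numberOpCLM = ½ Σ_j (hermiteOpCLM j − 1) = π(|x|² − (4π²)⁻¹Δ) − |σ|/2` with
  `numberOpCLM h_α = |α| h_α` (`|α| = α.degree`), i.e. the infinitesimal generator of the oscillator (torus) group acts
  diagonally on the Hermite basis with the degree as eigenvalue.

Everything is proved from Mathlib and the two imported tree files; no cited fact is used as a hypothesis.  Mathlib (at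
this pin) has the Schwartz directional-derivative calculus (`LineDeriv`, `SchwartzMap.lineDerivOp_apply_eq_fderiv`) and
the Laplacian notation class, but no harmonic oscillator / Hermite eigenfunctions on `𝓢`
(`lean search 'hermiteOpCLM|numberOpCLM|harmonic oscillator'`: none).

Motivation (not used in any statement): in the Schrödinger model of the oscillator (Weil) representation the compact
torus acts through `exp(iθ · numberOp)`-type one-parameter groups; §3–§4 are the Lie-algebra-level statement that this
torus is DIAGONAL on the Hermite basis with the polynomial degree as weight (Folland 1989, Prop. (4.49), §4.4), which is
what the archimedean `K`-type bookkeeping of theta correspondences rests on.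

## References

* G. B. Folland, *Harmonic Analysis in Phase Space*, Annals of Mathematics Studies 122, Princeton UP (1989): §1.7
  (vi) (the Hermite operator `2π(D_j² + X_j²) = 2πZ_jZ_j^* − 1 = 2πZ_j^*Z_j + 1`), Theorem (1.83) (the Hermite functions
  are an orthonormal eigenbasis), §1.7 (i) `D_j = (2πi)⁻¹∂/∂x_j`, `X_j = x_j`.  [cite: Folland1989, §1.7]

## Provenance

Written for the tree under the LEAN-IN-TREE rule (2026-08-18) by the pub-hodgecm formalisation cell (model-construction
sub-cell, seat mc-binder-2), over the tree files of the pv05/pv06 lineages (`FockHermite`, `HermiteSchwartz`).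
-/

set_option autoImplicit false

noncomputable section

open MvPolynomial Complex SchwartzMap
open scoped BigOperators Real LineDeriv

namespace Literature.Analysis.SegalBargmann

variable {σ : Type*} [Fintype σ] [DecidableEq σ]

/-! ## §1  Directional derivatives of the Hermite span in `𝓢(ℝ^σ, ℂ)` -/

section Directional

/-- **Constant-direction derivatives stay in the Hermite span**: for `v ∈ ℝ^σ`,
`D(hermiteSchwartz p)(x)(v) = hermiteSchwartz (dirSymb v p) (x)`, `dirSymb v p = Σ_j v_j (∂_j p − 2π x_j p)` — the
Schwartz-space transport of `fderiv_hermiteFun_apply`. [folklore] -/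
theorem fderiv_hermiteSchwartz_apply (p : MvPolynomial σ ℂ) (x v : EuclideanSpace ℝ σ) :
    fderiv ℝ (⇑(hermiteSchwartz p)) x v = hermiteSchwartz (dirSymb (⇑v : σ → ℝ) p) x := by
  rw [coe_hermiteSchwartz, hermiteSchwartz_apply]
  have hd : HasFDerivAt (fun y : EuclideanSpace ℝ σ => hermiteFun p (EuclideanSpace.equiv σ ℝ y))
      ((fderiv ℝ (hermiteFun p) (EuclideanSpace.equiv σ ℝ x)).comp
        (EuclideanSpace.equiv σ ℝ : EuclideanSpace ℝ σ →L[ℝ] (σ → ℝ))) x :=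
    ((differentiable_hermiteFun p) _).hasFDerivAt.comp x
      (EuclideanSpace.equiv σ ℝ : EuclideanSpace ℝ σ ≃L[ℝ] (σ → ℝ)).hasFDerivAt
  rw [hd.fderiv, ContinuousLinearMap.comp_apply, ContinuousLinearEquiv.coe_coe, fderiv_hermiteFun_apply]
  rfl

/-- The Schwartz-space directional derivative `∂_{v}` (Mathlib's `LineDeriv` on `𝓢`) of a Hermite-span function:
`∂_{v} (hermiteSchwartz p) = hermiteSchwartz (dirSymb v p)`. [folklore] -/
theorem lineDerivOp_hermiteSchwartz (p : MvPolynomial σ ℂ) (v : EuclideanSpace ℝ σ) :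
    ∂_{v} (hermiteSchwartz p) = hermiteSchwartz (dirSymb (⇑v : σ → ℝ) p) := by
  ext x
  rw [SchwartzMap.lineDerivOp_apply_eq_fderiv, fderiv_hermiteSchwartz_apply]

/-- The symbol of the derivative along a coordinate vector is `opDel j = ∂_j − 2π x_j`. [folklore] -/
theorem dirSymb_single (j : σ) (p : MvPolynomial σ ℂ) :
    dirSymb (Pi.single j (1 : ℝ)) p = opDel j p := by
  rw [dirSymb, Finset.sum_eq_single j]
  · rw [Pi.single_eq_same, Complex.ofReal_one, one_smul]
  · intro k _ hk
    rw [Pi.single_eq_of_ne hk, Complex.ofReal_zero, zero_smul]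
  · intro h
    exact absurd (Finset.mem_univ j) h

omit [Fintype σ] in
/-- The coordinate vector `e_j` of `EuclideanSpace ℝ σ` has coordinates `Pi.single j 1`. [folklore] -/
theorem coe_euclideanSingle (j : σ) :
    (⇑(EuclideanSpace.single j (1 : ℝ)) : σ → ℝ) = Pi.single j 1 :=
  rfl

/-- **`∂/∂x_j` on the Hermite span**: `∂_{e_j} (hermiteSchwartz p) = hermiteSchwartz (opDel j p)`,
`opDel j p = ∂_j p − 2π x_j p` (Folland 1989 §1.7: `∂_j(H e^{−πx²}) = (∂_jH − 2πx_jH)e^{−πx²}`). [folklore] -/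
theorem lineDerivOp_single_hermiteSchwartz (j : σ) (p : MvPolynomial σ ℂ) :
    ∂_{EuclideanSpace.single j (1 : ℝ)} (hermiteSchwartz p) = hermiteSchwartz (opDel j p) := by
  rw [lineDerivOp_hermiteSchwartz, coe_euclideanSingle, dirSymb_single]

end Directional

/-! ## §2  Multiplication by a coordinate on `𝓢(ℝ^σ, ℂ)` -/

section Multiplication

omit [DecidableEq σ] in
/-- **Multiplication by the coordinate `x_j`** as a continuous linear operator on `𝓢(ℝ^σ, ℂ)` (Folland's `X_j`;
Mathlib `SchwartzMap.smulLeftCLM` with the temperate-growth function `x ↦ x_j`). [folklore] -/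
def coordMulCLM (j : σ) : 𝓢(EuclideanSpace ℝ σ, ℂ) →L[ℂ] 𝓢(EuclideanSpace ℝ σ, ℂ) :=
  SchwartzMap.smulLeftCLM ℂ (fun x : EuclideanSpace ℝ σ => ((x j : ℝ) : ℂ))

omit [DecidableEq σ] in
/-- `(X_j f)(x) = x_j · f(x)`. [folklore] -/
theorem coordMulCLM_apply (j : σ) (f : 𝓢(EuclideanSpace ℝ σ, ℂ)) (x : EuclideanSpace ℝ σ) :
    coordMulCLM j f x = ((x j : ℝ) : ℂ) * f x := by
  rw [coordMulCLM, SchwartzMap.smulLeftCLM_apply_apply (hasTemperateGrowth_coordE j), smul_eq_mul]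

omit [DecidableEq σ] in
/-- **`X_j` on the Hermite span**: `X_j (hermiteSchwartz p) = hermiteSchwartz (opX j p) = hermiteSchwartz (x_j · p)`.
[folklore] -/
theorem coordMulCLM_hermiteSchwartz (j : σ) (p : MvPolynomial σ ℂ) :
    coordMulCLM j (hermiteSchwartz p) = hermiteSchwartz (opX j p) := by
  ext x
  rw [coordMulCLM_apply, hermiteSchwartz_apply, hermiteSchwartz_apply, opX_apply, hermiteFun_X_mul]

end Multiplication

/-! ## §3  Folland's `D_j` and the Hermite operator `2π(D_j² + X_j²)` on `𝓢(ℝ^σ, ℂ)` -/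

section Oscillator

/-- **Folland's `D_j = (2πi)⁻¹ ∂/∂x_j`** as a continuous linear operator on `𝓢(ℝ^σ, ℂ)` (§1.7 (i);
Mathlib `LineDeriv.lineDerivOpCLM` along the coordinate vector `e_j`). [cite: Folland1989, §1.7] -/
def opDCLM (j : σ) : 𝓢(EuclideanSpace ℝ σ, ℂ) →L[ℂ] 𝓢(EuclideanSpace ℝ σ, ℂ) :=
  (2 * π * I : ℂ)⁻¹ • LineDeriv.lineDerivOpCLM ℂ 𝓢(EuclideanSpace ℝ σ, ℂ) (EuclideanSpace.single j (1 : ℝ))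

/-- `(D_j f)(x) = (2πi)⁻¹ · ∂_{e_j} f (x)`. [folklore] -/
theorem opDCLM_apply (j : σ) (f : 𝓢(EuclideanSpace ℝ σ, ℂ)) (x : EuclideanSpace ℝ σ) :
    opDCLM j f x = (2 * π * I : ℂ)⁻¹ * (∂_{EuclideanSpace.single j (1 : ℝ)} f) x := rfl

/-- As Schwartz functions: `D_j f = (2πi)⁻¹ • ∂_{e_j} f`. [folklore] -/
theorem opDCLM_eq_smul (j : σ) (f : 𝓢(EuclideanSpace ℝ σ, ℂ)) :
    opDCLM j f = (2 * π * I : ℂ)⁻¹ • ∂_{EuclideanSpace.single j (1 : ℝ)} f := rfl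

/-- **`D_j` on the Hermite span** has symbol Folland's `opD j = (2πi)⁻¹ opDel j`:
`D_j (hermiteSchwartz p) = hermiteSchwartz (opD j p)`. [folklore] -/
theorem opDCLM_hermiteSchwartz (j : σ) (p : MvPolynomial σ ℂ) :
    opDCLM j (hermiteSchwartz p) = hermiteSchwartz (opD j p) := by
  rw [opDCLM_eq_smul, lineDerivOp_single_hermiteSchwartz, opD, LinearMap.smul_apply, hermiteSchwartz_smul]

/-- **The Hermite operator `2π(D_j² + X_j²)`** on `𝓢(ℝ^σ, ℂ)` (Folland 1989 §1.7 (vi); equal to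
`−(2π)⁻¹ ∂²/∂x_j² + 2π x_j²`, see `hermiteOpCLM_apply`). [cite: Folland1989, §1.7] -/
def hermiteOpCLM (j : σ) : 𝓢(EuclideanSpace ℝ σ, ℂ) →L[ℂ] 𝓢(EuclideanSpace ℝ σ, ℂ) :=
  (2 * π : ℂ) • ((opDCLM j).comp (opDCLM j) + (coordMulCLM j).comp (coordMulCLM j))

/-- **The Hermite operator acts on the Hermite span through its symbol**:
`2π(D_j² + X_j²) (hermiteSchwartz p) = hermiteSchwartz (hermiteOp j p)`, where
`hermiteOp j = 2π(opD j ∘ opD j + opX j ∘ opX j)` is the symbol operator of `FockHermite`. [folklore] -/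
theorem hermiteOpCLM_hermiteSchwartz (j : σ) (p : MvPolynomial σ ℂ) :
    hermiteOpCLM j (hermiteSchwartz p) = hermiteSchwartz (hermiteOp j p) := by
  have h1 : hermiteOpCLM j (hermiteSchwartz p) =
      (2 * π : ℂ) • (opDCLM j (opDCLM j (hermiteSchwartz p)) + coordMulCLM j (coordMulCLM j (hermiteSchwartz p))) :=
    rfl
  have h2 : hermiteOp j p = (2 * π : ℂ) • (opD j (opD j p) + opX j (opX j p)) := rfl
  rw [h1, h2, opDCLM_hermiteSchwartz, opDCLM_hermiteSchwartz, coordMulCLM_hermiteSchwartz,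
    coordMulCLM_hermiteSchwartz, ← hermiteSchwartz_add, ← hermiteSchwartz_smul]

/-- **Folland 1989, Theorem (1.83)(a) / §1.7 (vi): the Hermite functions are eigenfunctions of the Hermite operators**,
`2π(D_j² + X_j²) h_α = (2α_j + 1) h_α` for `h_α = hermiteSchwartz (herm α)`, `α ∈ ℕ^σ` — here a theorem about genuine
operators on `𝓢(ℝ^σ, ℂ)` (the symbol-level statement is `FockHermite.hermiteOp_herm`). [cite: Folland1989, Thm 1.83] -/
theorem hermiteOpCLM_herm (j : σ) (α : σ →₀ ℕ) :
    hermiteOpCLM j (hermiteSchwartz (herm α)) = (2 * (α j : ℂ) + 1) • hermiteSchwartz (herm α) := by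
  rw [hermiteOpCLM_hermiteSchwartz, hermiteOp_herm, hermiteSchwartz_smul]

/-- The oscillator constant: `2π · (2πi)⁻² = −(2π)⁻¹`. [folklore] -/
theorem two_pi_mul_inv_two_pi_I_sq (D : ℂ) :
    (2 * π : ℂ) * ((2 * π * I : ℂ)⁻¹ * ((2 * π * I : ℂ)⁻¹ * D)) = -((2 * π : ℂ)⁻¹) * D := by
  have hπ : (2 * π : ℂ) ≠ 0 := two_pi_ne_zero
  have hI : (2 * π * I : ℂ)⁻¹ * (2 * π * I : ℂ)⁻¹ = -((2 * π : ℂ)⁻¹ * (2 * π : ℂ)⁻¹) := by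
    rw [← mul_inv, ← mul_inv, show (2 * π * I : ℂ) * (2 * π * I) = -((2 * π) * (2 * π)) by
      rw [mul_mul_mul_comm, I_mul_I, mul_neg_one], inv_neg]
  rw [← mul_assoc ((2 * π * I : ℂ)⁻¹), hI, ← mul_assoc, mul_neg, ← mul_assoc, mul_inv_cancel₀ hπ, one_mul]

/-- **Explicit second-order form**: `2π(D_j² + X_j²) f = −(2π)⁻¹ ∂_{e_j}∂_{e_j} f + 2π x_j² f` pointwise. [folklore] -/
theorem hermiteOpCLM_apply (j : σ) (f : 𝓢(EuclideanSpace ℝ σ, ℂ)) (x : EuclideanSpace ℝ σ) :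
    hermiteOpCLM j f x =
      -((2 * π : ℂ)⁻¹) * (∂_{EuclideanSpace.single j (1 : ℝ)} (∂_{EuclideanSpace.single j (1 : ℝ)} f)) x +
        (2 * π : ℂ) * (((x j : ℝ) : ℂ) ^ 2 * f x) := by
  have h1 : hermiteOpCLM j f x =
      (2 * π : ℂ) * (opDCLM j (opDCLM j f) x + coordMulCLM j (coordMulCLM j f) x) := rfl
  have h2 : opDCLM j (opDCLM j f) x =
      (2 * π * I : ℂ)⁻¹ * ((2 * π * I : ℂ)⁻¹ *
        (∂_{EuclideanSpace.single j (1 : ℝ)} (∂_{EuclideanSpace.single j (1 : ℝ)} f)) x) := by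
    rw [opDCLM_apply, opDCLM_eq_smul, LineDeriv.lineDerivOp_smul]
    rfl
  rw [h1, h2, coordMulCLM_apply, coordMulCLM_apply, mul_add, two_pi_mul_inv_two_pi_I_sq]
  ring

end Oscillator

/-! ## §4  The number operator and the degree grading of the Hermite basis -/

section Number

/-- **The number operator** `N := ½ Σ_j (2π(D_j² + X_j²) − 1)` on `𝓢(ℝ^σ, ℂ)` — the oscillator Hamiltonian shifted
by its ground-state energy `|σ|/2`, so that the vacuum `h_0` has eigenvalue `0` (Folland 1989 §1.7:
`Σ_j π Z_j^* Z_j`). [cite: Folland1989, §1.7] -/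
def numberOpCLM : 𝓢(EuclideanSpace ℝ σ, ℂ) →L[ℂ] 𝓢(EuclideanSpace ℝ σ, ℂ) :=
  (1 / 2 : ℂ) • ∑ j : σ, (hermiteOpCLM j - ContinuousLinearMap.id ℂ 𝓢(EuclideanSpace ℝ σ, ℂ))

/-- **The Hermite functions diagonalise the number operator with the degree as eigenvalue**:
`N h_α = |α| · h_α`, `|α| = Σ_j α_j = α.degree` (from Theorem (1.83)(a) summed over `j`).  This is the infinitesimal
form of "the oscillator (torus) group acts on the Hermite basis through the character of weight `|α|`".
[cite: Folland1989, Thm 1.83] -/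
theorem numberOpCLM_herm (α : σ →₀ ℕ) :
    numberOpCLM (hermiteSchwartz (herm α)) = ((α.degree : ℕ) : ℂ) • hermiteSchwartz (herm (σ := σ) α) := by
  rw [numberOpCLM, smul_apply, sum_apply]
  simp_rw [sub_apply, ContinuousLinearMap.id_apply, hermiteOpCLM_herm]
  have h : ∀ j : σ, (2 * (α j : ℂ) + 1) • hermiteSchwartz (herm (σ := σ) α) - hermiteSchwartz (herm α) =
      (2 * (α j : ℂ)) • hermiteSchwartz (herm α) := fun j => by
    rw [add_smul, one_smul, add_sub_cancel_right]
  simp_rw [h]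
  rw [← Finset.sum_smul, smul_smul, Finsupp.degree_eq_sum, Nat.cast_sum, ← Finset.mul_sum]
  congr 1
  ring

/-- In particular the vacuum `h_0 = e^{−π|x|²}` (symbol `herm 0 = vac σ`) is annihilated by the number operator.
[folklore] -/
theorem numberOpCLM_herm_zero : numberOpCLM (hermiteSchwartz (herm (0 : σ →₀ ℕ))) = 0 := by
  rw [numberOpCLM_herm, map_zero, Nat.cast_zero, zero_smul]

end Number

end Literature.Analysis.SegalBargmann

end
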